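import Literature.AlgebraicGeometry.Motives.AbelianVarietyImage
import Literature.AlgebraicGeometry.Motives.AbelianVarietyKernelDimension
import Literature.AlgebraicGeometry.Motives.AbelianVarietyDimZeroProofs
import Literature.Topology.KrullDimensionDrop
import HarnessLib

/-!
# Dimension of the image; non-zero homomorphisms to simple abelian varieties are surjective

Consequences of the image factorisation `X ↠ im f ↪ Y` of a homomorphism of abelian varieties
(`Motives/AbelianVarietyImage`), for the topological Krull dimension `AbelianVariety.dim`
(`topologicalKrullDim_left`):

* `AbelianVariety.dim_image_le_left/right` — `dim (im f) ≤ dim X`, `dim (im f) ≤ dim Y`;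
* `AbelianVariety.dim_lt_of_isClosedImmersion_of_not_surjective` — a homomorphism `Z → Y` which is
  a closed immersion but not surjective has `dim Z < dim Y` (a proper closed subset of the
  irreducible `Y` has smaller dimension, `Literature.Topology.topologicalKrullDim_lt_of_isClosed_ssubset`);
* `AbelianVariety.dim_image_pos` — `f ≠ 0 ⇒ 0 < dim (im f)` (a homomorphism from a
  zero-dimensional abelian variety vanishes, `hom_eq_zero_of_dim_eq_zero`);
* `AbelianVariety.surjective_of_isSimple` — **a non-zero homomorphism to a simple abelian variety
  is surjective** (Mumford, *Abelian Varieties*, §19, proof of Cor. 2 of Thm. 1, p. 174: the image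
  is a non-zero abelian subvariety of the simple `Y`; Milne 1986, §12, proof of Lemma 12.7 /
  p. 191) — half of "a non-zero homomorphism between simple abelian varieties is an isogeny"
  (the hypothesis `hsimple` of `module_finite_hom_of_theoremOfCube_of_poincare`,
  `NumberTheory/DiophantineGeometry/AVIsogenyTateFinrankHomCubeProofs`);
* `AbelianVariety.isIsogeny_of_isSimple_of_ne_zero_end` — **every non-zero endomorphism of a simple
  abelian variety is an isogeny** (Mumford §19, Cor. 2 of Thm. 1 for `X = Y`; the hypothesis `hiso`
  of `exists_fg_saturation_end_of_degBound`): surjective by the above, hence an isogeny by the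
  dimension formula (`isIsogeny_of_surjective_end`, `Motives/AbelianVarietyKernelDimension`);
  `…_of_dim_eq` and `…_of_ne_zero_of_ne_zero` — the same for `X → Y` between simple abelian
  varieties of the same dimension, resp. admitting non-zero homomorphisms in both directions. The
  remaining case of Cor. 2 (`X`, `Y` simple, `Hom(X, Y) ≠ 0`, `Hom(Y, X) = 0`) needs the identity
  component of the kernel as an abelian subvariety and is not here.

## References

* D. Mumford, *Abelian Varieties* (1970), §19, Cor. 2 of Thm. 1 (p. 174 of the 2nd ed.).
  [MumfordAV1970]
* J. S. Milne, *Abelian Varieties*, in Cornell–Silverman (1986), §12 (PDF pp. 189–191).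
  [Milne1986AbelianVarieties]
-/

universe u

open CategoryTheory CategoryTheory.Limits AlgebraicGeometry

noncomputable section

namespace Literature.AlgebraicGeometry.Motives

namespace AbelianVariety

variable {K : Type u} [Field K] {X Y : AbelianVariety K} (f : X ⟶ Y)

/-- `dim (im f) ≤ dim X` (`X ↠ im f` is surjective and closed). [folklore] -/
theorem dim_image_le_left : (image f).dim ≤ X.dim := by
  have h := Literature.AlgebraicGeometry.Motives.Scheme.topologicalKrullDim_le_of_universallyClosed_of_surjective
    (Hom.toSchemeHom (toImage f))
  rw [topologicalKrullDim_left, topologicalKrullDim_left] at h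
  exact_mod_cast h

/-- **A proper abelian subvariety has smaller dimension**: if `i : Z → Y` is a homomorphism which
is a closed immersion but not surjective, then `dim Z < dim Y` (`Y` is irreducible).
[folklore] -/
theorem dim_lt_of_isClosedImmersion_of_not_surjective {Z : AbelianVariety K} (i : Z ⟶ Y)
    [IsClosedImmersion (Hom.toSchemeHom i)] (hi : ¬ Function.Surjective (Hom.toSchemeHom i)) :
    Z.dim < Y.dim := by
  set g := Hom.toSchemeHom i with hg
  haveI := irreducibleSpace_left Y
  have hW : IsClosed (Set.range g) := g.isClosedEmbedding.isClosed_range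
  have hWX : Set.range g ≠ Set.univ := fun h => hi (Set.range_eq_univ.1 h)
  have h1 : topologicalKrullDim (Set.range g) < (Y.dim : ℕ) :=
    Literature.Topology.topologicalKrullDim_lt_of_isClosed_ssubset hW hWX Y.dim
      (by rw [topologicalKrullDim_left]; exact_mod_cast Nat.lt_succ_self _)
  have h2 : topologicalKrullDim Z.X.left ≤ topologicalKrullDim (Set.range g) :=
    Literature.Topology.topologicalKrullDim_le_rangeFactorization g.continuous hW
      (fun a b _ hab => g.isClosedEmbedding.injective hab)
  have h3 := h2.trans_lt h1
  rw [topologicalKrullDim_left] at h3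
  exact_mod_cast h3

/-- `dim (im f) ≤ dim Y`. [folklore] -/
theorem dim_image_le_right : (image f).dim ≤ Y.dim := by
  by_cases h : Function.Surjective (Hom.toSchemeHom (imageι f))
  · haveI : Surjective (Hom.toSchemeHom (imageι f)) := ⟨h⟩
    have h'' : topologicalKrullDim (image f).X.left ≤ topologicalKrullDim Y.X.left :=
      Literature.Topology.topologicalKrullDim_le_rangeFactorization
        (Hom.toSchemeHom (imageι f)).continuous
        (Hom.toSchemeHom (imageι f)).isClosedEmbedding.isClosed_range
        (fun a b _ hab => (Hom.toSchemeHom (imageι f)).isClosedEmbedding.injective hab) |>.trans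
        (by rw [h.range_eq]; exact (IsHomeomorph.topologicalKrullDim_eq _
          (Homeomorph.Set.univ _).isHomeomorph).le)
    rw [topologicalKrullDim_left, topologicalKrullDim_left] at h''
    exact_mod_cast h''
  · exact (dim_lt_of_isClosedImmersion_of_not_surjective (imageι f) h).le

/-- **A non-zero homomorphism has positive-dimensional image**: if `dim (im f) = 0` then the
closed immersion `im f ↪ Y` is zero (`hom_eq_zero_of_dim_eq_zero`), so `f = (X ↠ im f) ≫ 0 = 0`.
[folklore] -/
theorem dim_image_pos (hf : f ≠ 0) : 0 < (image f).dim := by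
  by_contra h
  have h0 : (image f).dim = 0 := by omega
  apply hf
  rw [← toImage_imageι f, hom_eq_zero_of_dim_eq_zero (Or.inl h0) (imageι f), Limits.comp_zero]

/-- **A non-zero homomorphism to a simple abelian variety is surjective** (Mumford §19, proof of
Cor. 2 of Thm. 1: the image of `f` is an abelian subvariety `≠ 0` of `Y`, hence `Y`).
[cite: MumfordAV1970, §19 Cor. 2 of Thm. 1 (proof)] -/
theorem surjective_of_isSimple (hY : IsSimple Y) (hf : f ≠ 0) : Surjective (Hom.toSchemeHom f) := by
  by_contra hns
  have hns' : ¬ Function.Surjective (Hom.toSchemeHom (imageι f)) := fun h => hns ⟨by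
    rw [← toImage_imageι f]
    change Function.Surjective ((Hom.toSchemeHom (toImage f)) ≫ Hom.toSchemeHom (imageι f))
    rw [Scheme.Hom.comp_base]
    exact h.comp (surjective_toSchemeHom_toImage f).1⟩
  exact hY (image f) (imageι f) (isClosedImmersion_toSchemeHom_imageι f) (dim_image_pos f hf)
    (dim_lt_of_isClosedImmersion_of_not_surjective (imageι f) hns')

/-- A non-zero homomorphism to a simple abelian variety lowers dimension: `dim Y ≤ dim X`.
[folklore] -/
theorem dim_le_of_isSimple_of_ne_zero (hY : IsSimple Y) (hf : f ≠ 0) : Y.dim ≤ X.dim := by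
  haveI := surjective_of_isSimple f hY hf
  have h := Literature.AlgebraicGeometry.Motives.Scheme.topologicalKrullDim_le_of_universallyClosed_of_surjective
    (Hom.toSchemeHom f)
  rw [topologicalKrullDim_left, topologicalKrullDim_left] at h
  exact_mod_cast h

/-- **Every non-zero endomorphism of a simple abelian variety is an isogeny** (Mumford, *Abelian
Varieties*, §19, Cor. 2 of Thm. 1 with `X = Y`; Milne 1986, proof of Lemma 12.7: "every nonzero
element of `End(A)` is an isogeny"): it is surjective (`surjective_of_isSimple`), hence an isogeny
(`isIsogeny_of_surjective_end`, the dimension formula). [cite: MumfordAV1970, §19 Cor. 2 of Thm. 1] -/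
theorem isIsogeny_of_isSimple_of_ne_zero_end (hX : IsSimple X) (φ : X ⟶ X) (hφ : φ ≠ 0) :
    IsIsogeny φ := by
  haveI := surjective_of_isSimple φ hX hφ
  exact isIsogeny_of_surjective_end φ

/-- A non-zero homomorphism to a simple abelian variety of the same dimension is an isogeny.
[cite: MumfordAV1970, §19 Cor. 2 of Thm. 1] -/
theorem isIsogeny_of_isSimple_of_ne_zero_of_dim_eq (hY : IsSimple Y) (hf : f ≠ 0)
    (h : X.dim = Y.dim) : IsIsogeny f := by
  haveI := surjective_of_isSimple f hY hf
  exact isIsogeny_of_surjective_of_dim_eq f h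

/-- **Non-zero homomorphisms between simple abelian varieties admitting non-zero homomorphisms in
both directions are isogenies** (both are surjective, so the dimensions agree).
[cite: MumfordAV1970, §19 Cor. 2 of Thm. 1] -/
theorem isIsogeny_of_isSimple_of_ne_zero_of_ne_zero (hX : IsSimple X) (hY : IsSimple Y) (hf : f ≠ 0)
    {g : Y ⟶ X} (hg : g ≠ 0) : IsIsogeny f :=
  isIsogeny_of_isSimple_of_ne_zero_of_dim_eq f hY hf
    (le_antisymm (dim_le_of_isSimple_of_ne_zero g hX hg) (dim_le_of_isSimple_of_ne_zero f hY hf))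

end AbelianVariety

end Literature.AlgebraicGeometry.Motives
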